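import Mathlib
import HarnessLib
import Literature.NumberTheory.LFunctions.SuzukiCanonicalSystem
import Summits.RiemannHypothesis.RiemannHypothesis.Theorems.SuzukiWindowsDoorOpPath
import Summits.RiemannHypothesis.RiemannHypothesis.Theorems.SuzukiWindowsDoorPlumbing

/-!
# RiemannHypothesis / de Branges–Suzuki door — tail witness, file 3/4: integer-grid step inputs in `L²(ℝ)` and
their window images under the truncated Hankel operators (RH-FREE, ζ-FREE)

Cell rh-split, target T12 / spectral step L1 (statement of record: hypothesis of the landed p467879).  For a
continuous kernel `K` and the tree's operator path `𝖪[t] = SuzukiWindowsDoorOpPath.op hK t`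
(`f ↦ 1_{(−t,t)} ∫_{(−t,t)} K(·+y) f(y) dy` on `Lp ℝ 2 volume`), this file handles the CELL SPACE spanned by the
indicators `1_{(−j,1−j)}`, `j < N`:
* `inner_cellLp`, `inner_cell_cellComb`, `cellComb_injective`, `norm_cellComb_le` — orthonormal cells, coefficient
  recovery, injectivity of `c ↦ Σ_j c_j 1_{cell j}`, norm bound;
* `window_integral_cellComb`, `norm_sq_op_cellComb` — `‖𝖪[n](Σ_j c_j 1_{cell j})‖² = ∫_{(−n,n)} W_c²` with the shift
  window `W_c(x) = ∫_0^1 Σ_j c_j K(x + y − j) dy` (`N ≤ n`);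
* `intervalIntegral_sq_le_window`, continuity of `(c,x) ↦ W_c(x)` and of `c ↦ ∫_{−R}^{R} W_c²`.
Zero definitions.  Filed by rh-split-typer-2 g2 (--supports stmt-RiemannHypothesis-19728).
RH-free measure theory; nothing here bears on the truth of RH.
-/

set_option linter.dupNamespace false

noncomputable section

/-! ## 8. The shift witness: integer-grid step inputs (concrete `L²(ℝ)` part) -/

namespace Summit.RiemannHypothesis.RiemannHypothesis.Theorems.SuzukiDoorTailWitness

open MeasureTheory Set
open Literature.NumberTheory.LFunctions
open Summit.RiemannHypothesis.RiemannHypothesis.Theorems.SuzukiWindowsDoorOpPath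
open Summit.RiemannHypothesis.RiemannHypothesis.Cruxes.WindowsImplyContraction.Plumbing

/-- The unit cells `(−j, 1−j)` have finite Lebesgue measure. -/
theorem volume_cell_ne_top (j : ℕ) : volume (Ioo (-(j : ℝ)) (1 - j)) ≠ ⊤ := by
  rw [Real.volume_Ioo]; exact ENNReal.ofReal_ne_top

/-- The unit cells have measure one. -/
theorem volume_real_cell (j : ℕ) : volume.real (Ioo (-(j : ℝ)) (1 - j)) = 1 := by
  rw [measureReal_def, Real.volume_Ioo, ENNReal.toReal_ofReal (by linarith)]
  ring

/-- Distinct unit cells are disjoint. -/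
theorem cell_inter_eq_empty {i j : ℕ} (h : i ≠ j) :
    Ioo (-(i : ℝ)) (1 - i) ∩ Ioo (-(j : ℝ)) (1 - j) = ∅ := by
  rcases Nat.lt_or_gt_of_ne h with hij | hij
  · have hle : (i : ℝ) + 1 ≤ j := by exact_mod_cast hij
    ext x
    simp only [mem_inter_iff, mem_Ioo, mem_empty_iff_false, iff_false, not_and, and_imp]
    intro h1 _ h3 _
    linarith
  · have hle : (j : ℝ) + 1 ≤ i := by exact_mod_cast hij
    ext x
    simp only [mem_inter_iff, mem_Ioo, mem_empty_iff_false, iff_false, not_and, and_imp]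
    intro h1 h2 h3 h4
    linarith

/-- `‖1_{cell j}‖_{L²} = 1`. -/
theorem norm_cellLp (j : ℕ) :
    ‖(indicatorConstLp 2 (measurableSet_Ioo (a := -(j : ℝ)) (b := 1 - j)) (volume_cell_ne_top j) (1 : ℝ) :
      Lp ℝ 2 (volume : Measure ℝ))‖ = 1 := by
  rw [norm_indicatorConstLp (by norm_num) (by norm_num), volume_real_cell]
  simp

open scoped InnerProductSpace in
/-- Orthonormality of the cell indicators: `⟪1_{cell i}, 1_{cell j}⟫ = δ_{ij}`. -/
theorem inner_cellLp (i j : ℕ) :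
    ⟪(indicatorConstLp 2 (measurableSet_Ioo (a := -(i : ℝ)) (b := 1 - i)) (volume_cell_ne_top i) (1 : ℝ) :
      Lp ℝ 2 (volume : Measure ℝ)),
     (indicatorConstLp 2 (measurableSet_Ioo (a := -(j : ℝ)) (b := 1 - j)) (volume_cell_ne_top j) (1 : ℝ) :
      Lp ℝ 2 (volume : Measure ℝ))⟫_ℝ = if i = j then 1 else 0 := by
  rw [L2.inner_indicatorConstLp_indicatorConstLp measurableSet_Ioo measurableSet_Ioo
    (volume_cell_ne_top i) (volume_cell_ne_top j)]
  by_cases h : i = j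
  · subst h; rw [inter_self, volume_real_cell]; simp
  · rw [cell_inter_eq_empty h]; simp [h]

variable {K : ℝ → ℝ}

/-- The window integrand `(u, y) ↦ Σ_j c_j K(u + y − j)` is jointly continuous (in `c`, `u`, `y`). -/
theorem continuous_shiftSum (hK : Continuous K) (N : ℕ) :
    Continuous fun q : ((Fin N → ℝ) × ℝ) × ℝ =>
      ∑ j : Fin N, q.1.1 j * K (q.1.2 + q.2 - ((j : ℕ) : ℝ)) := by
  refine continuous_finsetSum _ fun j _ => ?_
  have h1 : Continuous fun q : ((Fin N → ℝ) × ℝ) × ℝ => q.1.1 j :=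
    (continuous_apply j).comp (continuous_fst.comp continuous_fst)
  have h2 : Continuous fun q : ((Fin N → ℝ) × ℝ) × ℝ => q.1.2 + q.2 - ((j : ℕ) : ℝ) :=
    ((continuous_snd.comp continuous_fst).add continuous_snd).sub continuous_const
  exact h1.mul (hK.comp h2)

/-- The shift window `W_c(u) = ∫_0^1 Σ_j c_j K(u + y − j) dy` is jointly continuous in `(c, u)`. -/
theorem continuous_shiftWindow (hK : Continuous K) (N : ℕ) :
    Continuous fun p : (Fin N → ℝ) × ℝ =>
      ∫ y in (0 : ℝ)..1, ∑ j : Fin N, p.1 j * K (p.2 + y - ((j : ℕ) : ℝ)) := by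
  have h2 : Continuous (Function.uncurry fun (p : (Fin N → ℝ) × ℝ) (y : ℝ) =>
      ∑ j : Fin N, p.1 j * K (p.2 + y - ((j : ℕ) : ℝ))) := continuous_shiftSum hK N
  exact intervalIntegral.continuous_parametric_intervalIntegral_of_continuous' h2 0 1

/-- For fixed `c`, `u ↦ W_c(u)` is continuous. -/
theorem continuous_shiftWindow_right (hK : Continuous K) {N : ℕ} (c : Fin N → ℝ) :
    Continuous fun u : ℝ => ∫ y in (0 : ℝ)..1, ∑ j : Fin N, c j * K (u + y - ((j : ℕ) : ℝ)) :=
  (continuous_shiftWindow hK N).comp (continuous_const.prodMk continuous_id)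

/-- `c ↦ ∫_{−R}^{R} W_c(u)² du` is continuous. -/
theorem continuous_sqInt (hK : Continuous K) (N : ℕ) (R : ℝ) :
    Continuous fun c : Fin N → ℝ =>
      ∫ u in (-R)..R, (∫ y in (0 : ℝ)..1, ∑ j : Fin N, c j * K (u + y - ((j : ℕ) : ℝ))) ^ 2 := by
  have h := (continuous_shiftWindow hK N).pow 2
  exact intervalIntegral.continuous_parametric_intervalIntegral_of_continuous' h (-R) R

/-- The one-cell integral: `∫_{(−n,n)} 1_{(−j,1−j)}(y) K(x + y) dy = ∫_0^1 K(x + y − j) dy` for `j + 1 ≤ n`. -/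
theorem setIntegral_indicator_cell (x : ℝ) {j n : ℕ} (hjn : j + 1 ≤ n) :
    ∫ y in Ioo (-(n : ℝ)) n, (Ioo (-(j : ℝ)) (1 - j)).indicator (fun _ => (1 : ℝ)) y * K (x + y) =
      ∫ y in (0 : ℝ)..1, K (x + y - ((j : ℕ) : ℝ)) := by
  have hsub : Ioo (-(j : ℝ)) (1 - j) ⊆ Ioo (-(n : ℝ)) n := by
    have h1 : (j : ℝ) + 1 ≤ n := by exact_mod_cast hjn
    intro y hy
    simp only [mem_Ioo] at hy ⊢
    constructor <;> linarith [hy.1, hy.2]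
  have heq : (fun y => (Ioo (-(j : ℝ)) (1 - j)).indicator (fun _ => (1 : ℝ)) y * K (x + y)) =
      (Ioo (-(j : ℝ)) (1 - j)).indicator (fun y => K (x + y)) := by
    funext y
    by_cases hy : y ∈ Ioo (-(j : ℝ)) (1 - j)
    · rw [indicator_of_mem hy, indicator_of_mem hy, one_mul]
    · rw [indicator_of_notMem hy, indicator_of_notMem hy, zero_mul]
  rw [heq, setIntegral_indicator measurableSet_Ioo, inter_eq_self_of_subset_right hsub]
  have hle : (-(j : ℝ)) ≤ 1 - j := by linarith
  rw [← integral_Ioc_eq_integral_Ioo, ← intervalIntegral.integral_of_le hle]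
  have := intervalIntegral.integral_comp_sub_right (fun y => K (x + y)) ((j : ℕ) : ℝ) (a := 0) (b := 1)
  simp only [zero_sub] at this
  rw [← this]
  refine intervalIntegral.integral_congr fun y _ => ?_
  congr 1
  ring

/-! ## 9. The cell map `c ↦ Σ_j c_j 1_{(−j,1−j)}` into `L²(ℝ)` -/

/-- a.e. representative of `Σ_j c_j 1_{cell j}`. -/
theorem coeFn_cellComb {N : ℕ} (c : Fin N → ℝ) :
    ((Fintype.linearCombination ℝ (fun j : Fin N =>
        (indicatorConstLp 2 (measurableSet_Ioo (a := -((j : ℕ) : ℝ)) (b := 1 - ((j : ℕ) : ℝ)))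
          (volume_cell_ne_top j) (1 : ℝ) : Lp ℝ 2 (volume : Measure ℝ))) c : Lp ℝ 2 (volume : Measure ℝ))
        : ℝ → ℝ) =ᵐ[volume]
      fun y => ∑ j : Fin N, c j * (Ioo (-((j : ℕ) : ℝ)) (1 - ((j : ℕ) : ℝ))).indicator (fun _ => (1 : ℝ)) y := by
  rw [Fintype.linearCombination_apply]
  have h1 : ∀ j : Fin N,
      ((c j • (indicatorConstLp 2 (measurableSet_Ioo (a := -((j : ℕ) : ℝ)) (b := 1 - ((j : ℕ) : ℝ)))
          (volume_cell_ne_top j) (1 : ℝ) : Lp ℝ 2 (volume : Measure ℝ)) : Lp ℝ 2 (volume : Measure ℝ))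
          : ℝ → ℝ) =ᵐ[volume]
        fun y => c j * (Ioo (-((j : ℕ) : ℝ)) (1 - ((j : ℕ) : ℝ))).indicator (fun _ => (1 : ℝ)) y := by
    intro j
    filter_upwards [Lp.coeFn_smul (c j)
        (indicatorConstLp 2 (measurableSet_Ioo (a := -((j : ℕ) : ℝ)) (b := 1 - ((j : ℕ) : ℝ)))
          (volume_cell_ne_top j) (1 : ℝ) : Lp ℝ 2 (volume : Measure ℝ)),
      indicatorConstLp_coeFn (p := 2) (hs := measurableSet_Ioo (a := -((j : ℕ) : ℝ)) (b := 1 - ((j : ℕ) : ℝ)))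
        (hμs := volume_cell_ne_top j) (c := (1 : ℝ)) (μ := (volume : Measure ℝ))] with y hy hind
    rw [hy, Pi.smul_apply, hind, smul_eq_mul]
  have h2 := Filter.eventually_all.2 h1
  filter_upwards [Lp.coeFn_fun_finsetSum Finset.univ (fun j : Fin N =>
      (c j • (indicatorConstLp 2 (measurableSet_Ioo (a := -((j : ℕ) : ℝ)) (b := 1 - ((j : ℕ) : ℝ)))
        (volume_cell_ne_top j) (1 : ℝ) : Lp ℝ 2 (volume : Measure ℝ)))), h2] with y hy hall
  rw [hy]
  exact Finset.sum_congr rfl fun j _ => hall j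

open scoped InnerProductSpace in
/-- Coefficient recovery: `⟪1_{cell i}, Σ_j c_j 1_{cell j}⟫ = c_i`. -/
theorem inner_cell_cellComb {N : ℕ} (c : Fin N → ℝ) (i : Fin N) :
    ⟪(indicatorConstLp 2 (measurableSet_Ioo (a := -((i : ℕ) : ℝ)) (b := 1 - ((i : ℕ) : ℝ)))
        (volume_cell_ne_top i) (1 : ℝ) : Lp ℝ 2 (volume : Measure ℝ)),
      (Fintype.linearCombination ℝ (fun j : Fin N =>
        (indicatorConstLp 2 (measurableSet_Ioo (a := -((j : ℕ) : ℝ)) (b := 1 - ((j : ℕ) : ℝ)))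
          (volume_cell_ne_top j) (1 : ℝ) : Lp ℝ 2 (volume : Measure ℝ))) c : Lp ℝ 2 (volume : Measure ℝ))⟫_ℝ
      = c i := by
  rw [Fintype.linearCombination_apply, inner_sum]
  simp_rw [real_inner_smul_right, inner_cellLp]
  have : ∀ j : Fin N, (c j * if (i : ℕ) = (j : ℕ) then (1 : ℝ) else 0) = if i = j then c i else 0 := by
    intro j
    by_cases h : i = j
    · subst h; simp
    · have h' : (i : ℕ) ≠ (j : ℕ) := fun e => h (Fin.ext e)
      simp [h, h']
  simp_rw [this]
  simp

/-- The cell map is injective. -/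
theorem cellComb_injective (N : ℕ) :
    Function.Injective (Fintype.linearCombination ℝ (fun j : Fin N =>
        (indicatorConstLp 2 (measurableSet_Ioo (a := -((j : ℕ) : ℝ)) (b := 1 - ((j : ℕ) : ℝ)))
          (volume_cell_ne_top j) (1 : ℝ) : Lp ℝ 2 (volume : Measure ℝ)))) := by
  refine (injective_iff_map_eq_zero _).2 fun c hc => ?_
  funext i
  have := inner_cell_cellComb c i
  rw [hc, inner_zero_right] at this
  exact this.symm

/-- Norm bound `‖Σ_j c_j 1_{cell j}‖ ≤ N` for `‖c‖ ≤ 1` (sup norm). -/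
theorem norm_cellComb_le {N : ℕ} (c : Fin N → ℝ) (hc : ‖c‖ ≤ 1) :
    ‖(Fintype.linearCombination ℝ (fun j : Fin N =>
        (indicatorConstLp 2 (measurableSet_Ioo (a := -((j : ℕ) : ℝ)) (b := 1 - ((j : ℕ) : ℝ)))
          (volume_cell_ne_top j) (1 : ℝ) : Lp ℝ 2 (volume : Measure ℝ))) c : Lp ℝ 2 (volume : Measure ℝ))‖
      ≤ N := by
  rw [Fintype.linearCombination_apply]
  calc ‖∑ j : Fin N, c j • (indicatorConstLp 2 (measurableSet_Ioo (a := -((j : ℕ) : ℝ)) (b := 1 - ((j : ℕ) : ℝ)))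
          (volume_cell_ne_top j) (1 : ℝ) : Lp ℝ 2 (volume : Measure ℝ))‖
      ≤ ∑ j : Fin N, ‖c j • (indicatorConstLp 2 (measurableSet_Ioo (a := -((j : ℕ) : ℝ)) (b := 1 - ((j : ℕ) : ℝ)))
          (volume_cell_ne_top j) (1 : ℝ) : Lp ℝ 2 (volume : Measure ℝ))‖ := norm_sum_le _ _
    _ ≤ ∑ _j : Fin N, (1 : ℝ) := by
        refine Finset.sum_le_sum fun j _ => ?_
        rw [norm_smul, norm_cellLp, mul_one]
        exact (norm_le_pi_norm c j).trans hc
    _ = N := by simp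

/-! ## 10. The window integral of a step input -/

/-- On the window `(−n,n)` with `N ≤ n`: `∫_{(−n,n)} K(x+y) (Σ_j c_j 1_{cell j})(y) dy = ∫_0^1 Σ_j c_j K(x + y − j) dy`. -/
theorem window_integral_cellComb (hK : Continuous K) {N n : ℕ} (hNn : N ≤ n) (c : Fin N → ℝ) (x : ℝ) :
    ∫ y in Ioo (-(n : ℝ)) n, K (x + y) *
        ((Fintype.linearCombination ℝ (fun j : Fin N =>
          (indicatorConstLp 2 (measurableSet_Ioo (a := -((j : ℕ) : ℝ)) (b := 1 - ((j : ℕ) : ℝ)))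
            (volume_cell_ne_top j) (1 : ℝ) : Lp ℝ 2 (volume : Measure ℝ))) c : Lp ℝ 2 (volume : Measure ℝ))
          : ℝ → ℝ) y
      = ∫ y in (0 : ℝ)..1, ∑ j : Fin N, c j * K (x + y - ((j : ℕ) : ℝ)) := by
  -- replace the L² class by its step representative
  have hae := coeFn_cellComb c
  have step1 : ∫ y in Ioo (-(n : ℝ)) n, K (x + y) *
        ((Fintype.linearCombination ℝ (fun j : Fin N =>
          (indicatorConstLp 2 (measurableSet_Ioo (a := -((j : ℕ) : ℝ)) (b := 1 - ((j : ℕ) : ℝ)))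
            (volume_cell_ne_top j) (1 : ℝ) : Lp ℝ 2 (volume : Measure ℝ))) c : Lp ℝ 2 (volume : Measure ℝ))
          : ℝ → ℝ) y
      = ∫ y in Ioo (-(n : ℝ)) n, ∑ j : Fin N, c j *
          ((Ioo (-((j : ℕ) : ℝ)) (1 - ((j : ℕ) : ℝ))).indicator (fun _ => (1 : ℝ)) y * K (x + y)) := by
    refine integral_congr_ae ((ae_restrict_of_ae hae).mono fun y hy => ?_)
    beta_reduce at hy ⊢
    rw [hy, Finset.mul_sum]
    refine Finset.sum_congr rfl fun j _ => ?_
    ring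
  rw [step1]
  -- integrability of each term on the window
  have hint : ∀ j : Fin N, Integrable (fun y => c j *
      ((Ioo (-((j : ℕ) : ℝ)) (1 - ((j : ℕ) : ℝ))).indicator (fun _ => (1 : ℝ)) y * K (x + y)))
      (volume.restrict (Ioo (-(n : ℝ)) n)) := by
    intro j
    have hKi : IntegrableOn (fun y => K (x + y)) (Ioo (-(n : ℝ)) n) volume :=
      ((hK.comp (continuous_const.add continuous_id)).continuousOn.integrableOn_Icc).mono_set
        Ioo_subset_Icc_self
    have heq : (fun y => (Ioo (-((j : ℕ) : ℝ)) (1 - ((j : ℕ) : ℝ))).indicator (fun _ => (1 : ℝ)) y * K (x + y))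
        = (Ioo (-((j : ℕ) : ℝ)) (1 - ((j : ℕ) : ℝ))).indicator (fun y => K (x + y)) := by
      funext y
      by_cases hy : y ∈ Ioo (-((j : ℕ) : ℝ)) (1 - ((j : ℕ) : ℝ))
      · rw [indicator_of_mem hy, indicator_of_mem hy, one_mul]
      · rw [indicator_of_notMem hy, indicator_of_notMem hy, zero_mul]
    have : Integrable ((Ioo (-((j : ℕ) : ℝ)) (1 - ((j : ℕ) : ℝ))).indicator (fun y => K (x + y)))
        (volume.restrict (Ioo (-(n : ℝ)) n)) := hKi.indicator measurableSet_Ioo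
    rw [← heq] at this
    exact this.const_mul (c j)
  rw [integral_finsetSum _ fun j _ => hint j]
  simp_rw [integral_const_mul]
  have hcell : ∀ j : Fin N, ∫ y in Ioo (-(n : ℝ)) n,
      (Ioo (-((j : ℕ) : ℝ)) (1 - ((j : ℕ) : ℝ))).indicator (fun _ => (1 : ℝ)) y * K (x + y)
      = ∫ y in (0 : ℝ)..1, K (x + y - ((j : ℕ) : ℝ)) :=
    fun j => setIntegral_indicator_cell x (by have := j.2; omega)
  simp_rw [hcell]
  -- back to one interval integral
  have hii : ∀ j : Fin N, IntervalIntegrable (fun y => c j * K (x + y - ((j : ℕ) : ℝ))) volume 0 1 :=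
    fun j => (continuous_const.mul (hK.comp ((continuous_const.add continuous_id).sub
      continuous_const))).intervalIntegrable 0 1
  rw [intervalIntegral.integral_finsetSum fun j _ => hii j]
  refine Finset.sum_congr rfl fun j _ => ?_
  rw [intervalIntegral.integral_const_mul]

/-- **Window norm of a step input.** For `N ≤ n`:
`‖𝖪[n] (Σ_j c_j 1_{cell j})‖² = ∫_{(−n,n)} W_c(x)² dx`, `W_c(x) = ∫_0^1 Σ_j c_j K(x + y − j) dy`. -/
theorem norm_sq_op_cellComb (hK : Continuous K) {N n : ℕ} (hNn : N ≤ n) (c : Fin N → ℝ) :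
    ‖op hK n ((Fintype.linearCombination ℝ (fun j : Fin N =>
          (indicatorConstLp 2 (measurableSet_Ioo (a := -((j : ℕ) : ℝ)) (b := 1 - ((j : ℕ) : ℝ)))
            (volume_cell_ne_top j) (1 : ℝ) : Lp ℝ 2 (volume : Measure ℝ))) c : Lp ℝ 2 (volume : Measure ℝ)))‖ ^ 2
      = ∫ x in Ioo (-(n : ℝ)) n, (∫ y in (0 : ℝ)..1, ∑ j : Fin N, c j * K (x + y - ((j : ℕ) : ℝ))) ^ 2 := by
  set g : Lp ℝ 2 (volume : Measure ℝ) := (Fintype.linearCombination ℝ (fun j : Fin N =>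
          (indicatorConstLp 2 (measurableSet_Ioo (a := -((j : ℕ) : ℝ)) (b := 1 - ((j : ℕ) : ℝ)))
            (volume_cell_ne_top j) (1 : ℝ) : Lp ℝ 2 (volume : Measure ℝ))) c) with hg
  rw [norm_sq_eq_integral_sq, ← integral_indicator measurableSet_Ioo]
  refine integral_congr_ae ((op_repr hK n g).mono fun x hx => ?_)
  beta_reduce at hx ⊢
  rw [hx]
  by_cases hxm : x ∈ Ioo (-(n : ℝ)) n
  · rw [indicator_of_mem hxm, indicator_of_mem hxm, hg, window_integral_cellComb hK hNn c x]
  · rw [indicator_of_notMem hxm, indicator_of_notMem hxm]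
    ring

/-- Sub-window bound: for `m + 1 ≤ n`, `∫_{−m}^{m} W_c² ≤ ∫_{(−n,n)} W_c²`. -/
theorem intervalIntegral_sq_le_window (hK : Continuous K) {N : ℕ} (c : Fin N → ℝ) {m n : ℕ} (hmn : m + 1 ≤ n) :
    ∫ x in (-(m : ℝ))..m, (∫ y in (0 : ℝ)..1, ∑ j : Fin N, c j * K (x + y - ((j : ℕ) : ℝ))) ^ 2
      ≤ ∫ x in Ioo (-(n : ℝ)) n, (∫ y in (0 : ℝ)..1, ∑ j : Fin N, c j * K (x + y - ((j : ℕ) : ℝ))) ^ 2 := by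
  have hW := continuous_shiftWindow_right hK c
  have hm0 : (-(m : ℝ)) ≤ m := by
    have : (0 : ℝ) ≤ m := Nat.cast_nonneg m
    linarith
  rw [intervalIntegral.integral_of_le hm0]
  refine setIntegral_mono_set ?_ ?_ ?_
  · exact ((hW.pow 2).continuousOn.integrableOn_Icc).mono_set Ioo_subset_Icc_self
  · exact ae_of_all _ fun x => sq_nonneg _
  · have h1 : (m : ℝ) + 1 ≤ n := by exact_mod_cast hmn
    have hsub : Ioc (-(m : ℝ)) m ⊆ Ioo (-(n : ℝ)) n := fun x hx =>
      ⟨by linarith [hx.1], by linarith [hx.2]⟩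
    exact hsub.eventuallyLE

end Summit.RiemannHypothesis.RiemannHypothesis.Theorems.SuzukiDoorTailWitness

end
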